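import Summits.QuantumFields.YangMills.Theorems.DiagonalMirrorRPRWilsonDiagonalModelChainFubini

/-!
# Crux `DiagonalMirrorRPR` (stmt-QuantumFields-10604), line `sign-twisted-diagonal-trace`, construction F1_diag
# (director-ym O4 WORD 3 (A)), S4d₃: `Tr K_u^m = Σ'_{k ∈ ℕ^{ℤ_m}} ∫_X ∏_t 𝔞((k_t,X_t),(k_{t+1},X_{t+1})) dX` — the `Y`-integrations

Helper for the crux `DiagonalMirrorRPR` of `YangMills` (routes `IsotropyFromPowerCounting`, `MirrorModularBoosts`,
`PencilRigidity`; item stmt-QuantumFields-10604), attached `--supports … --as helper`; it closes nothing by itself.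
Continuation of `…ChainFubini` (`diagCyclicTraceU_eq_tsum_integral`).  This file COMPLETES the path-integral side (S4d) of the
trace formula for the Wilson diagonal two-step transfer matrix on the odd torus in the `u`-chart: the cyclic trace
`diagCyclicTraceU ρ β m = Tr K_u^m` equals the cyclic `m`-fold integral of the symmetric Hilbert–Schmidt kernel
`𝔞 = natKernel ρ β` on `ℕ × HalfCfg` (`liftMeasure = counting ⊗ halfHaar`), written as `Σ'_k ∫_X`.

* `linkFactor` — the `Y_t`-dependent factor after cyclic re-indexing (the integrand of `𝔞((k_{t-1},X_{t-1}),(k_t,X_t))`);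
* `prod_chainFactor_eq`, `prod_natKernel_eq` — the two cyclic re-indexings (`Fintype.prod_equiv (Equiv.addRight 1)`);
* ★ `integral_prod_chainFactor_eq` — `∫ ∏_t chainFactor k = ∫_X ∏_t 𝔞((k_t,X_t),(k_{t+1},X_{t+1}))` (zip
  `measurePreserving_arrowProdEquivProdArrow`, Fubini, `integral_fintype_prod_eq_prod`);
* ★ **`diagCyclicTraceU_eq_tsum_integral_natKernel`** — `Tr K_u^m = Σ'_{k} ∫_X ∏_t 𝔞((k_t,X_t),(k_{t+1},X_{t+1})) d(halfHaar)^{ℤ_m}`.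

OWED: the spectral side `Σ_i κ_i^m = ` the same cyclic integral (S4e: kernels of powers of the lifted operator of
`…LiftedOp`, Parseval in its eigenbasis), then (S5) `sp/sm/top` and (P) the pairing layer of `DiagonalSliceModel`.
HONEST FRAMING: construction helper; no `def wilsonDiagonalModel`; nothing about D_old ⟨10604⟩, the RP crux of the FOLD restate, or
the summit is proved; the Yang–Mills mass gap is NOT proved here or anywhere in the tree.
-/

set_option autoImplicit false

noncomputable section

open scoped BigOperators ENNReal
open MeasureTheory
open Literature.MathematicalPhysics.QuantumLattice Literature.MathematicalPhysics.QuantumFieldTheory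
open Summit.QuantumFields.YangMills.Cruxes.DiagonalMirrorRPR.ParityBridgeColdTraces

namespace Summit.QuantumFields.YangMills.Cruxes.DiagonalMirrorRPR.SignTwistedDiagonalTrace.WilsonDiagonal

/-! ## §28 `Tr K_u^m = Σ'_{k ∈ ℕ^{ℤ_m}} ∫_X ∏_t 𝔞((k_t, X_t), (k_{t+1}, X_{t+1})) dX` (the `Y`-integrations) -/

section ChainKernel

variable {S : ℕ} [NeZero S] {G : Type} [Group G] {Nc : ℕ} (ρ : G →* Matrix (Fin Nc) (Fin Nc) ℂ)
variable [TopologicalSpace G] [IsTopologicalGroup G] [CompactSpace G] [MeasurableSpace G] [BorelSpace G]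
  [SecondCountableTopology G]

/-- The `Y_t`-dependent part of the chain integrand after the cyclic re-indexing `t ↦ t - 1` of the `Θ`-feature and of the odd
weight: `ψ_{k_{t-1}}(w(Θ y)) · e^{β odd(X_{t-1}, y, X_t)} · ψ_{k_t}(w(y))` — exactly the integrand of
`𝔞((k_{t-1}, X_{t-1}), (k_t, X_t))` (`natKernel`) without its two `e^{β/2 · inslab}` prefactors. -/
def linkFactor (β : ℝ) {m : ℕ} (k : ZMod m → ℕ) (X : ZMod m → HalfCfg S S G) (t : ZMod m) (y : HalfCfg S S G) : ℝ :=
  natFeature (p := featDim S Nc) β (k (t - 1)) (bondVec ρ (thetaHalf y)) * Real.exp (β * oddActionU ρ (X (t - 1)) y (X t)) *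
    natFeature (p := featDim S Nc) β (k t) (bondVec ρ y)

omit [TopologicalSpace G] [IsTopologicalGroup G] [CompactSpace G] [MeasurableSpace G] [BorelSpace G]
  [SecondCountableTopology G] in
/-- Cyclic re-indexing: `∏_t chainFactor k (Y, X) t = (∏_t e^{β inslab X_t}) · ∏_t linkFactor k X t (Y t)`. -/
theorem prod_chainFactor_eq (β : ℝ) {m : ℕ} [NeZero m] (k : ZMod m → ℕ) (Y X : ZMod m → HalfCfg S S G) :
    ∏ t, chainFactor ρ β k (fun t => (Y t, X t)) t =
      (∏ t, Real.exp (β * inslabAction ρ (X t))) * ∏ t, linkFactor ρ β k X t (Y t) := by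
  simp only [chainFactor, linkFactor, Finset.prod_mul_distrib]
  have h1 : ∏ t, natFeature (p := featDim S Nc) β (k t) (bondVec ρ (thetaHalf (Y (t + 1)))) =
      ∏ t, natFeature (p := featDim S Nc) β (k (t - 1)) (bondVec ρ (thetaHalf (Y t))) :=
    Fintype.prod_equiv (Equiv.addRight 1) _ _ fun t => by simp only [Equiv.coe_addRight, add_sub_cancel_right]
  have h2 : ∏ t, Real.exp (β * oddActionU ρ (X t) (Y (t + 1)) (X (t + 1))) =
      ∏ t, Real.exp (β * oddActionU ρ (X (t - 1)) (Y t) (X t)) :=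
    Fintype.prod_equiv (Equiv.addRight 1) _ _ fun t => by simp only [Equiv.coe_addRight, add_sub_cancel_right]
  rw [h1, h2]; ring

omit [SecondCountableTopology G] in
/-- Cyclic re-indexing on the kernel side: `∏_t 𝔞((k_t,X_t),(k_{t+1},X_{t+1})) = (∏_t e^{β inslab X_t}) · ∏_t ∫ linkFactor k X t dy`
(the two `e^{β/2 inslab}` prefactors of consecutive `𝔞`'s recombine). -/
theorem prod_natKernel_eq (β : ℝ) {m : ℕ} [NeZero m] (k : ZMod m → ℕ) (X : ZMod m → HalfCfg S S G) :
    ∏ t, natKernel ρ β (k t, X t) (k (t + 1), X (t + 1)) =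
      (∏ t, Real.exp (β * inslabAction ρ (X t))) * ∏ t, ∫ y, linkFactor ρ β k X t y ∂(halfHaar S G) := by
  have h1 : ∏ t, natKernel ρ β (k t, X t) (k (t + 1), X (t + 1)) = ∏ t, natKernel ρ β (k (t - 1), X (t - 1)) (k t, X t) :=
    Fintype.prod_equiv (Equiv.addRight 1) _ _ fun t => by simp only [Equiv.coe_addRight, add_sub_cancel_right]
  rw [h1]
  simp only [natKernel, linkFactor, Finset.prod_mul_distrib]
  have h2 : ∏ t, Real.exp (β / 2 * inslabAction ρ (X (t - 1))) = ∏ t, Real.exp (β / 2 * inslabAction ρ (X t)) :=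
    (Fintype.prod_equiv (Equiv.addRight 1) _ _ fun t => by simp only [Equiv.coe_addRight, add_sub_cancel_right]).symm
  rw [h2, ← Finset.prod_mul_distrib]
  congr 1
  refine Finset.prod_congr rfl fun t _ => ?_
  rw [← Real.exp_add]
  congr 1; ring

/-- ★ **The `Y`-integrations** (`m ≥ 1`, `β ≥ 0`, `ρ` continuous): for every feature multi-index `k`,
`∫ ∏_t chainFactor k P t d(halfHaar ⊗ halfHaar)^{ℤ_m} = ∫_X ∏_t 𝔞((k_t, X_t), (k_{t+1}, X_{t+1})) d(halfHaar)^{ℤ_m}`: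
zip `P = (Y, X)` (`measurePreserving_arrowProdEquivProdArrow`), Fubini `X` outside (bounded measurable integrand on a finite
measure), then the `Y_t`-integrals factor (`integral_fintype_prod_eq_prod`) into the integrals defining `𝔞`. -/
theorem integral_prod_chainFactor_eq (hρ : Continuous ρ) {β : ℝ} (hβ : 0 ≤ β) {m : ℕ} [NeZero m] (k : ZMod m → ℕ) :
    ∫ P : ZMod m → HalfCfg S S G × HalfCfg S S G, ∏ t, chainFactor ρ β k P t
        ∂(Measure.pi fun _ : ZMod m => (halfHaar S G).prod (halfHaar S G)) =
      ∫ X : ZMod m → HalfCfg S S G, ∏ t, natKernel ρ β (k t, X t) (k (t + 1), X (t + 1))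
        ∂(Measure.pi fun _ : ZMod m => halfHaar S G) := by
  haveI : IsFiniteMeasure (halfHaar S G) := by unfold halfHaar; infer_instance
  have hmp := measurePreserving_arrowProdEquivProdArrow (HalfCfg S S G) (HalfCfg S S G) (ZMod m)
    (fun _ => halfHaar S G) (fun _ => halfHaar S G)
  have hF : Measurable fun P : ZMod m → HalfCfg S S G × HalfCfg S S G => ∏ t, chainFactor ρ β k P t :=
    Finset.measurable_prod _ fun t _ => measurable_chainFactor ρ hρ β k t
  have step1 : ∫ P : ZMod m → HalfCfg S S G × HalfCfg S S G, ∏ t, chainFactor ρ β k P t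
        ∂(Measure.pi fun _ : ZMod m => (halfHaar S G).prod (halfHaar S G)) =
      ∫ q : (ZMod m → HalfCfg S S G) × (ZMod m → HalfCfg S S G), ∏ t, chainFactor ρ β k (fun t => (q.1 t, q.2 t)) t
        ∂((Measure.pi fun _ : ZMod m => halfHaar S G).prod (Measure.pi fun _ : ZMod m => halfHaar S G)) :=
    ((hmp.symm _).integral_comp' (fun P => ∏ t, chainFactor ρ β k P t)).symm
  have hf : Integrable (fun q : (ZMod m → HalfCfg S S G) × (ZMod m → HalfCfg S S G) =>
      ∏ t, chainFactor ρ β k (fun t => (q.1 t, q.2 t)) t)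
      ((Measure.pi fun _ : ZMod m => halfHaar S G).prod (Measure.pi fun _ : ZMod m => halfHaar S G)) := by
    obtain ⟨B, hB⟩ := exists_hasSum_abs_prod_chainFactor_le ρ hρ hβ m (S := S) (G := G)
    have hmeas : Measurable fun q : (ZMod m → HalfCfg S S G) × (ZMod m → HalfCfg S S G) =>
        ∏ t, chainFactor ρ β k (fun t => (q.1 t, q.2 t)) t :=
      hF.comp (MeasurableEquiv.arrowProdEquivProdArrow (HalfCfg S S G) (HalfCfg S S G) (ZMod m)).symm.measurable
    refine Integrable.of_bound hmeas.aestronglyMeasurable B (ae_of_all _ fun q => ?_)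
    obtain ⟨s, hs, hsB⟩ := hB (fun t => (q.1 t, q.2 t))
    rw [Real.norm_eq_abs]
    exact (le_hasSum hs k fun j _ => abs_nonneg _).trans hsB
  rw [step1, integral_prod_symm _ hf]
  refine integral_congr_ae (ae_of_all _ fun X => ?_)
  dsimp only
  rw [prod_natKernel_eq]
  simp_rw [prod_chainFactor_eq]
  rw [integral_const_mul, integral_fintype_prod_eq_prod (linkFactor ρ β k X)]

/-- ★ **`Tr K_u^m` through the lifted kernel** (`m ≥ 1`, `β ≥ 0`, `ρ` continuous unitary):
`diagCyclicTraceU ρ β m = Σ'_{k ∈ ℕ^{ℤ_m}} ∫_X ∏_{t ∈ ℤ_m} 𝔞((k_t, X_t), (k_{t+1}, X_{t+1})) d(halfHaar)^{ℤ_m}` — the cyclic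
`m`-fold "integral" of the symmetric lifted kernel `𝔞 = natKernel ρ β` over `(counting ⊗ halfHaar)^{ℤ_m}`, written as a sum over
the discrete coordinates of an integral over the continuous ones.  This is the path-integral side of the trace formula
`Σ_i κ_i^m = Tr K_u^m` (spectral side OWED, S4e). -/
theorem diagCyclicTraceU_eq_tsum_integral_natKernel (hρ : Continuous ρ) {β : ℝ} (hβ : 0 ≤ β)
    (hρu : ∀ g, ρ g ∈ Matrix.unitaryGroup (Fin Nc) ℂ) (m : ℕ) [NeZero m] :
    diagCyclicTraceU ρ β m (S := S) (G := G) =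
      ∑' k : ZMod m → ℕ, ∫ X : ZMod m → HalfCfg S S G, ∏ t, natKernel ρ β (k t, X t) (k (t + 1), X (t + 1))
        ∂(Measure.pi fun _ : ZMod m => halfHaar S G) := by
  rw [diagCyclicTraceU_eq_tsum_integral ρ hρ hβ hρu m]
  exact tsum_congr fun k => integral_prod_chainFactor_eq ρ hρ hβ k

end ChainKernel

end Summit.QuantumFields.YangMills.Cruxes.DiagonalMirrorRPR.SignTwistedDiagonalTrace.WilsonDiagonal

end
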